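import Summits.SmoothPoincare4.SmoothPoincare4.Theorems.DottedCircleRasmussenDcrGapHelperFriendsCarrierVkPartCSmoothInv

/-!
# Helper `helper_friendsCarrier_Vk_partC` (V_k part C: the collar of the uninverted model disc exterior) —
# piece 7: the size function and the near-end / far-end parts of the collar
(item stmt-SmoothPoincare4-16128, route route-SmoothPoincare4-DottedCircleRasmussen)

Seventh piece of the port of the tree's `SliceDiscEndCollar.lean` to `M_k ⊂ ℝ⁴` (definitions in
`…VkPartCDatum`).  The SIZE FUNCTION `M = ρ + χ` on the exterior `O = ℝ⁴ ∖ (D_k ∪ Δ)`: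
`ρ = E_{s₀}(depth)` on the shell `Φ((0, 2ε) × M_k)` (template: `E_{s₀}(1 - ‖z‖)`, there defined on the whole
ball), `χ = E_1(‖w‖)` at the tube points `G(x, w)` — both extended by `0`.

* continuity of `ρ` and `χ`, hence of `M`, on the exterior: each is continuous on an open set, vanishes off a
  set `K`, and `closure K ∩ O` lies in that open set because `K` sits in a COMPACT set whose points off `D_k`
  are in the open set (`Φ([0, s₀] × M_k)`, resp. `G(B̄(0, 1 - s₁/2) × B̄(0,1)) ∪ Φ([0, s₁/2] × unit tube)`) —
  this replaces the template's sequence argument `eventually_one_le_norm_snd`;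
* `M = e^{-σ}` on the collar region (`Pres.M_eq_exp`) and `M = 0` on the rest of the exterior;
* the near-end part `c(Y × (-∞, a]) = {z ∈ O | e^{-a} ≤ M z}` and the far part
  `(O ∖ region) ∪ c(Y × [a, ∞)) = {z ∈ O | M z ≤ e^{-a}}`, both relatively closed in `O`;
* `helper_friendsCarrier_Vk_partC_size` — the registered summary (the near-end parts of the collar are
  relatively closed in the exterior).

Everything is proved; no definitions, no named facts, no `sorry`.
References: Manolescu–Piccirillo (2023), §3.2 [ManolescuPiccirillo2023]; Kirby (1989), Ch. I §5 [Kirby1989].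
-/

-- the prescribed namespace `Summit.<P>.<Sub>.…` duplicates `SmoothPoincare4` (P = Sub)
set_option linter.dupNamespace false
set_option linter.style.longLine false

noncomputable section

open scoped Manifold ContDiff Topology
open Function Set Metric
open Literature.Topology.FourManifolds Literature.Topology.FourManifolds.MMSW

namespace Summit.SmoothPoincare4.SmoothPoincare4.Theorems.DcrGap.MkFriends

namespace FriendsVk

/-- **Continuity of a function extended by zero**: `f` is continuous at the points of an open `U` inside
`O`, vanishes off `K`, and the closure points of `K` inside `O` lie in `U`; then `f` is continuous on `O`.
[folklore] -/
theorem continuousOn_of_vanishing {X : Type*} [TopologicalSpace X] {f : X → ℝ} {U K O : Set X}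
    (hf : ∀ x ∈ U, x ∈ O → ContinuousAt f x) (hK : ∀ x, x ∉ K → f x = 0) (hcl : closure K ∩ O ⊆ U) : ContinuousOn f O := by
  intro z hz
  refine ContinuousAt.continuousWithinAt ?_
  by_cases hzU : z ∈ U
  · exact hf z hzU hz
  · have hzK : z ∉ closure K := fun h => hzU (hcl ⟨h, hz⟩)
    have hev : f =ᶠ[𝓝 z] fun _ => 0 := by
      filter_upwards [isClosed_closure.isOpen_compl.mem_nhds hzK] with x hx
      exact hK x fun h => hx (subset_closure h)
    exact continuousAt_const.congr_of_eventuallyEq hev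

namespace CollarDatum

variable {k : ℕ} (V : CollarDatum k)

/-! ### The normal-radius size `χ` -/

/-- The normal-radius size in the tube neighbourhood. [folklore] -/
theorem χ_of_mem {z : EuclideanSpace ℝ (Fin 4)} (hz : z ∈ V.N) : V.χ z = SliceCollar.E 1 ‖(V.Ginv z).2‖ := if_pos hz

/-- The normal-radius size off the tube neighbourhood vanishes. [folklore] -/
theorem χ_of_not_mem {z : EuclideanSpace ℝ (Fin 4)} (hz : z ∉ V.N) : V.χ z = 0 := if_neg hz

/-- The normal-radius size is nonnegative. [folklore] -/
theorem χ_nonneg (z : EuclideanSpace ℝ (Fin 4)) : 0 ≤ V.χ z := by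
  by_cases hz : z ∈ V.N
  · rw [V.χ_of_mem hz]; exact SliceCollar.E_nonneg _ _
  · rw [V.χ_of_not_mem hz]

/-- The normal-radius size vanishes off the unit tube `G(D̊² × B(0,1))` of the open disc. [folklore] -/
theorem χ_eq_zero_of_not_mem {z : EuclideanSpace ℝ (Fin 4)} (hz : z ∉ V.G '' (ball (0 : EuclideanSpace ℝ (Fin 2)) 1 ×ˢ ball (0 : EuclideanSpace ℝ (Fin 2)) 1)) :
    V.χ z = 0 := by
  by_cases hzN : z ∈ V.N
  · rw [V.χ_of_mem hzN]
    have hq := V.Ginv_mem hzN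
    obtain ⟨hx1, -⟩ := ConicalDiscTube.mem_dom_iff.1 hq
    have hw1 : 1 ≤ ‖(V.Ginv z).2‖ := by
      by_contra h
      rw [not_le] at h
      exact hz ⟨V.Ginv z, ⟨by simpa using hx1, by rw [mem_ball, dist_zero_right]; exact h⟩, V.G_Ginv hzN⟩
    exact SliceCollar.E_of_le one_pos (by linarith) hw1
  · exact V.χ_of_not_mem hzN

/-- A compact set containing the unit tube of the open disc: `G(B̄(0, 1 - s₁/2) × B̄(0,1)) ∪ Φ([0, s₁/2] × unit tube)`. [folklore] -/
theorem isCompact_tubeHull : IsCompact (V.G '' (closedBall (0 : EuclideanSpace ℝ (Fin 2)) (1 - V.s₁ / 2) ×ˢ closedBall (0 : EuclideanSpace ℝ (Fin 2)) 1) ∪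
    V.Φ '' (Icc 0 (V.s₁ / 2) ×ˢ V.unitTube)) := by
  refine IsCompact.union ?_ ((isCompact_Icc.prod V.isCompact_unitTube).image V.continuous_Φ)
  refine ((isCompact_closedBall _ _).prod (isCompact_closedBall _ _)).image_of_continuousOn (V.contDiffOn.continuousOn.mono ?_)
  intro q hq
  rw [mem_prod, mem_closedBall, mem_closedBall, dist_zero_right, dist_zero_right] at hq
  exact ⟨by rw [mem_ball, dist_zero_right]; linarith [hq.1, V.width_pos], by rw [mem_ball, dist_zero_right]; linarith [hq.2]⟩

/-- The unit tube of the open disc lies in the compact hull. [folklore] -/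
theorem image_unitBall_subset_tubeHull : V.G '' (ball (0 : EuclideanSpace ℝ (Fin 2)) 1 ×ˢ ball (0 : EuclideanSpace ℝ (Fin 2)) 1) ⊆
    V.G '' (closedBall (0 : EuclideanSpace ℝ (Fin 2)) (1 - V.s₁ / 2) ×ˢ closedBall (0 : EuclideanSpace ℝ (Fin 2)) 1) ∪ V.Φ '' (Icc 0 (V.s₁ / 2) ×ˢ V.unitTube) := by
  rintro _ ⟨⟨x, w⟩, ⟨hx, hw⟩, rfl⟩
  rw [mem_ball, dist_zero_right] at hx hw
  rcases le_or_gt ‖x‖ (1 - V.s₁ / 2) with hle | hgt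
  · exact Or.inl ⟨(x, w), ⟨by rw [mem_closedBall, dist_zero_right]; exact hle, by rw [mem_closedBall, dist_zero_right]; exact hw.le⟩, rfl⟩
  · refine Or.inr ⟨(1 - ‖x‖, V.ν (radialProjection (spherePt 1) x, w)), ⟨⟨by linarith, by linarith⟩, ?_⟩, ?_⟩
    · rw [V.mem_unitTube_iff]; exact hw.le
    · exact (V.G_eq_Φ (by linarith [V.width_pos]) hx (by linarith)).symm

/-- Points of the compact hull off `D_k` lie in the tube neighbourhood `N`. [folklore] -/
theorem mem_N_of_mem_tubeHull {z : EuclideanSpace ℝ (Fin 4)}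
    (hz : z ∈ V.G '' (closedBall (0 : EuclideanSpace ℝ (Fin 2)) (1 - V.s₁ / 2) ×ˢ closedBall (0 : EuclideanSpace ℝ (Fin 2)) 1) ∪ V.Φ '' (Icc 0 (V.s₁ / 2) ×ˢ V.unitTube))
    (hzD : z ∉ modelHandlebody k) : z ∈ V.N := by
  rcases hz with ⟨q, hq, rfl⟩ | ⟨⟨s, a⟩, ⟨⟨hs0, hs1⟩, hat⟩, rfl⟩
  · rw [mem_prod, mem_closedBall, mem_closedBall, dist_zero_right, dist_zero_right] at hq
    exact ⟨q, ConicalDiscTube.mem_dom_iff.2 ⟨by linarith [hq.1, V.width_pos], by linarith [hq.2]⟩, rfl⟩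
  · obtain ⟨⟨u, w⟩, ⟨-, hw⟩, rfl⟩ := hat
    rw [mem_closedBall, dist_zero_right] at hw
    have hspos : 0 < s := by
      by_contra h
      have hs : s = 0 := le_antisymm (not_lt.1 h) hs0
      apply hzD
      simp only [hs, V.Φ_zero]
      exact modelBoundary_subset_modelHandlebody (V.ν_mem _)
    refine ⟨((1 - s) • (u : EuclideanSpace ℝ (Fin 2)), w), ConicalDiscTube.mem_dom_iff.2 ⟨?_, by simp only; linarith⟩, ?_⟩
    · simp only; rw [norm_smul_coe_sphere (by linarith [V.width_lt_one])]; linarith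
    · rw [V.cone u (1 - s) w (by linarith) (by linarith) (by linarith), sub_sub_cancel]

/-- **The normal-radius size is continuous on the exterior.** [folklore] -/
theorem continuousOn_χ : ContinuousOn V.χ V.O := by
  refine continuousOn_of_vanishing (U := V.N) (K := V.G '' (ball (0 : EuclideanSpace ℝ (Fin 2)) 1 ×ˢ ball (0 : EuclideanSpace ℝ (Fin 2)) 1))
    (fun z hzN hzO => ?_) (fun z hz => V.χ_eq_zero_of_not_mem hz) ?_
  · -- in the tube: locally `E_1 (‖w‖)` with `w ≠ 0`
    have hw : (V.Ginv z).2 ≠ 0 := V.snd_ne_zero_of_not_mem_disc (V.Ginv_mem hzN) (by rw [V.G_Ginv hzN]; exact hzO.2)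
    have hev : V.χ =ᶠ[𝓝 z] fun z' => SliceCollar.E 1 ‖(V.Ginv z').2‖ := by
      filter_upwards [V.isOpen_N.mem_nhds hzN] with z' hz'
      exact V.χ_of_mem hz'
    refine ContinuousAt.congr_of_eventuallyEq ?_ hev
    have hco : ContinuousAt (fun z' => ‖(V.Ginv z').2‖) z :=
      (continuous_norm.comp continuous_snd).continuousAt.comp (V.contDiffAt_Ginv hzN).continuousAt
    exact ContinuousAt.comp (g := SliceCollar.E 1) (SliceCollar.contDiffAt_E 1 (norm_pos_iff.2 hw)).continuousAt hco
  · rintro z ⟨hz, hzO⟩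
    have hz' := (V.isCompact_tubeHull.isClosed.closure_subset_iff.2 V.image_unitBall_subset_tubeHull) hz
    exact V.mem_N_of_mem_tubeHull hz' hzO.1

/-! ### The depth size `ρ` -/

/-- The depth size on the shell. [folklore] -/
theorem ρ_of_mem {z : EuclideanSpace ℝ (Fin 4)} (hz : z ∈ V.shell (2 * V.ε)) : V.ρ z = SliceCollar.E V.s₀ (depth k z) := if_pos hz

/-- The depth size off the shell vanishes. [folklore] -/
theorem ρ_of_not_mem {z : EuclideanSpace ℝ (Fin 4)} (hz : z ∉ V.shell (2 * V.ε)) : V.ρ z = 0 := if_neg hz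

/-- The depth size is nonnegative. [folklore] -/
theorem ρ_nonneg (z : EuclideanSpace ℝ (Fin 4)) : 0 ≤ V.ρ z := by
  by_cases hz : z ∈ V.shell (2 * V.ε)
  · rw [V.ρ_of_mem hz]; exact SliceCollar.E_nonneg _ _
  · rw [V.ρ_of_not_mem hz]

/-- The depth size vanishes off the thin shell `Φ((0, s₀) × M_k)`. [folklore] -/
theorem ρ_eq_zero_of_not_mem {z : EuclideanSpace ℝ (Fin 4)} (hz : z ∉ V.shell V.s₀) : V.ρ z = 0 := by
  by_cases hz2 : z ∈ V.shell (2 * V.ε)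
  · rw [V.ρ_of_mem hz2]
    have hd : V.s₀ ≤ depth k z := by
      by_contra h; exact hz ⟨hz2.1, hz2.2.1, not_le.1 h⟩
    exact SliceCollar.E_of_le V.s₀_pos hz2.2.1 hd
  · exact V.ρ_of_not_mem hz2

/-- On the thin shell the depth size is `E_{s₀}(depth)`. [folklore] -/
theorem ρ_of_mem_shell {z : EuclideanSpace ℝ (Fin 4)} (hz : z ∈ V.shell V.s₀) : V.ρ z = SliceCollar.E V.s₀ (depth k z) :=
  V.ρ_of_mem (V.shell_mono V.s₀_lt_two.le hz)

/-- **The depth size is continuous on the exterior.** [folklore] -/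
theorem continuousOn_ρ : ContinuousOn V.ρ V.O := by
  refine continuousOn_of_vanishing (U := V.shell (2 * V.ε)) (K := V.shell V.s₀) (fun z hz _ => ?_) (fun z hz => V.ρ_eq_zero_of_not_mem hz) ?_
  · have hev : V.ρ =ᶠ[𝓝 z] fun z' => SliceCollar.E V.s₀ (depth k z') := by
      filter_upwards [(V.isOpen_shell _).mem_nhds hz] with z' hz'
      exact V.ρ_of_mem hz'
    refine ContinuousAt.congr_of_eventuallyEq ?_ hev
    exact ContinuousAt.comp (g := SliceCollar.E V.s₀) (SliceCollar.contDiffAt_E V.s₀ hz.2.1).continuousAt (V.contDiffAt_depth hz.1).continuousAt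
  · rintro z ⟨hz, hzO⟩
    have hz' := ((V.isCompact_image_Icc V.s₀).isClosed.closure_subset_iff.2 (V.shell_subset_image V.s₀)) hz
    exact V.mem_shell_of_mem_image V.s₀_lt_two V.s₀_lt_two hz' hzO.1

/-- **The size function is continuous on the exterior.** [folklore] -/
theorem continuousOn_M : ContinuousOn V.M V.O := V.continuousOn_ρ.add V.continuousOn_χ

/-- The size function is nonnegative. [folklore] -/
theorem M_nonneg (z : EuclideanSpace ℝ (Fin 4)) : 0 ≤ V.M z := add_nonneg (V.ρ_nonneg z) (V.χ_nonneg z)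

/-- **On the rest of the exterior the size vanishes.** [folklore] -/
theorem M_eq_zero_of_not_mem_region {z : EuclideanSpace ℝ (Fin 4)} (hzO : z ∈ V.O) (hz : z ∉ V.region) : V.M z = 0 := by
  have hρ : V.ρ z = 0 := V.ρ_eq_zero_of_not_mem fun h => hz (Or.inl ⟨h, hzO.2⟩)
  have hχ : V.χ z = 0 := by
    refine V.χ_eq_zero_of_not_mem ?_
    rintro ⟨⟨x, w⟩, ⟨hx, hw⟩, rfl⟩
    rw [mem_ball, dist_zero_right] at hx hw
    have hw0 : w ≠ 0 := by
      rintro rfl; exact hzO.2 (V.G_zero_mem_disc hx)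
    exact hz (Or.inr ⟨(x, w), ⟨by rwa [mem_ball, dist_zero_right], by rwa [mem_ball, dist_zero_right], hw0⟩, rfl⟩)
  rw [CollarDatum.M, hρ, hχ, add_zero]

/-- The depth size at a tube point `G (x, w)` is `E_{s₀}(1 - ‖x‖)` (both vanish over the deep disc). [folklore] -/
theorem ρ_G {q : (EuclideanSpace ℝ (Fin 2)) × (EuclideanSpace ℝ (Fin 2))} (hq : q ∈ (ConicalDiscTube.dom : Set ((EuclideanSpace ℝ (Fin 2)) × (EuclideanSpace ℝ (Fin 2))))) :
    V.ρ (V.G q) = SliceCollar.E V.s₀ (1 - ‖q.1‖) := by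
  obtain ⟨x, w⟩ := q
  obtain ⟨hx1, hw2⟩ := ConicalDiscTube.mem_dom_iff.1 hq
  simp only at hx1 hw2 ⊢
  rcases lt_or_ge (1 - V.s₁) ‖x‖ with h | h
  · have hs : |1 - ‖x‖| < 2 * V.ε := by rw [abs_of_nonneg (by linarith)]; linarith [V.s₁_lt]
    have hmem : V.G (x, w) ∈ V.shell (2 * V.ε) := by
      rw [V.G_eq_Φ h hx1 hw2]; exact (V.Φ_mem_shell_iff (V.ν_mem _) hs _).2 ⟨by linarith, by linarith [V.s₁_lt]⟩
    rw [V.ρ_of_mem hmem, V.G_eq_Φ h hx1 hw2, V.depth_Φ (V.ν_mem _) hs]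
  · rw [V.ρ_eq_zero_of_not_mem (V.G_not_mem_shell (by linarith [V.s₀_lt]) hw2),
      SliceCollar.E_of_le V.s₀_pos (by linarith) (by linarith [V.s₀_lt])]

namespace Pres

variable {V} {Y : Type*} [TopologicalSpace Y] [ChartedSpace (EuclideanSpace ℝ (Fin 3)) Y] (Q : V.Pres Y)

/-- **On the collar region the size is `e^{-σ}`.** [folklore] -/
theorem M_eq_exp {z : EuclideanSpace ℝ (Fin 4)} (hz : z ∈ V.region) : V.M z = Real.exp (-(V.collarInv Q.jM Q.jB z).2) := by
  by_cases hrad : z ∈ V.radSetT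
  · -- shell branch: `σ = -log E_{s₀}(depth z)` and `χ = 0`
    obtain ⟨hshell, hdir⟩ := hrad
    rw [V.collarInv_of_mem_radSetT ⟨hshell, hdir⟩, CollarDatum.ΨRad]
    simp only [neg_neg]
    rw [Real.exp_log (SliceCollar.E_pos V.s₀_pos hshell.2.1 hshell.2.2), CollarDatum.M, V.ρ_of_mem_shell hshell]
    suffices hχ : V.χ z = 0 by rw [hχ, add_zero]
    by_cases hzN : z ∈ V.N
    · rw [V.χ_of_mem hzN]
      obtain ⟨-, hw1⟩ := V.shallow_of_mem_radSetT (V.Ginv_mem hzN) (by rw [V.G_Ginv hzN]; exact ⟨hshell, hdir⟩)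
      exact SliceCollar.E_of_le one_pos (by linarith) hw1.le
    · exact V.χ_of_not_mem hzN
  · have hN := V.mem_N_of_region hz hrad
    have hq := V.Ginv_mem hN
    have hGz := V.G_Ginv hN
    obtain ⟨hx1, hw2⟩ := ConicalDiscTube.mem_dom_iff.1 hq
    have hρ : V.ρ z = SliceCollar.E V.s₀ (1 - ‖(V.Ginv z).1‖) := by rw [← hGz, V.ρ_G hq, V.Ginv_apply hq]
    rw [CollarDatum.M, V.χ_of_mem hN, hρ]
    have hw : (V.Ginv z).2 ≠ 0 := V.snd_ne_zero_of_not_mem_disc hq (by rw [hGz]; exact V.not_mem_disc_of_mem_region hz)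
    by_cases hx : (V.Ginv z).1 = 0
    · -- flat branch
      rw [V.collarInv_of_fst_eq_zero hrad hx, CollarDatum.ΨFlat]
      simp only [neg_neg]
      have hw1 : ‖(V.Ginv z).2‖ < 1 := V.norm_snd_lt_one hq (by rw [hGz]; exact hz) (by rw [hx]; simp; linarith [V.depth₀_lt_one])
      rw [Real.exp_log (SliceCollar.E_pos one_pos (norm_pos_iff.2 hw) hw1), hx, norm_zero, sub_zero,
        SliceCollar.E_of_le V.s₀_pos one_pos V.depth₀_lt_one.le, zero_add]
    · -- tube branch: `σ = h = -log F`
      have hP : (1 - ‖(V.Ginv z).1‖, ‖(V.Ginv z).2‖) ∈ SliceCollar.P V.s₀ := V.mem_P_of_region hq hx (by rw [hGz]; exact hz)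
      rw [V.collarInv_of_fst_ne_zero hrad hx, CollarDatum.ΨTube, CollarDatum.profB]
      simp only [SliceCollar.Ψ, SliceCollar.hgt, neg_neg]
      rw [Real.exp_log (SliceCollar.F_pos V.s₀_pos hP), SliceCollar.F]

/-! ### The near-end and the far part of the collar -/

/-- **The near-end part of the collar**: `c(Y × (-∞, a]) = {z ∈ O | e^{-a} ≤ M z}`. [folklore] -/
theorem image_collar_le (a : ℝ) : V.collar Q.jM Q.jB Q.ψ '' {p | p.2 ≤ a} = {z | z ∈ V.O ∧ Real.exp (-a) ≤ V.M z} := by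
  rw [Q.image_collar_eq]
  ext z
  constructor
  · rintro ⟨hz, hle⟩
    refine ⟨V.region_subset_O hz, ?_⟩
    rw [Q.M_eq_exp hz]
    exact Real.exp_le_exp.2 (neg_le_neg hle)
  · rintro ⟨hzO, hM⟩
    have hz : z ∈ V.region := by
      by_contra h
      rw [V.M_eq_zero_of_not_mem_region hzO h] at hM
      exact absurd hM (not_le.2 (Real.exp_pos _))
    refine ⟨hz, ?_⟩
    rw [Q.M_eq_exp hz, Real.exp_le_exp, neg_le_neg_iff] at hM
    exact hM

/-- **The far part**: `(O ∖ region) ∪ c(Y × [a, ∞)) = {z ∈ O | M z ≤ e^{-a}}`. [folklore] -/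
theorem diff_union_image_collar_ge (a : ℝ) :
    (V.O \ V.region) ∪ V.collar Q.jM Q.jB Q.ψ '' {p | a ≤ p.2} = {z | z ∈ V.O ∧ V.M z ≤ Real.exp (-a)} := by
  rw [Q.image_collar_eq]
  ext z
  constructor
  · rintro (⟨hzO, hz⟩ | ⟨hz, hle⟩)
    · exact ⟨hzO, by rw [V.M_eq_zero_of_not_mem_region hzO hz]; exact (Real.exp_pos _).le⟩
    · refine ⟨V.region_subset_O hz, ?_⟩
      rw [Q.M_eq_exp hz]
      exact Real.exp_le_exp.2 (neg_le_neg hle)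
  · rintro ⟨hzO, hM⟩
    by_cases hz : z ∈ V.region
    · refine Or.inr ⟨hz, ?_⟩
      rw [Q.M_eq_exp hz, Real.exp_le_exp, neg_le_neg_iff] at hM
      exact hM
    · exact Or.inl ⟨hzO, hz⟩

end Pres

/-- Relative closedness of a superlevel set of the size in the exterior. [folklore] -/
theorem closure_setOf_le_M_inter {c : ℝ} : closure {z | z ∈ V.O ∧ c ≤ V.M z} ∩ V.O ⊆ {z | z ∈ V.O ∧ c ≤ V.M z} := by
  rintro z ⟨hz, hzO⟩
  refine ⟨hzO, ?_⟩
  obtain ⟨u, hu, hlim⟩ := mem_closure_iff_seq_limit.1 hz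
  have hO : IsOpen V.O := by
    have : V.O = (modelHandlebody k ∪ V.disc)ᶜ := by ext x; simp [CollarDatum.O, CollarDatum.disc]
    rw [this]; exact ((isClosed_modelHandlebody k).union V.isClosed_disc).isOpen_compl
  have hcont : ContinuousAt V.M z := (V.continuousOn_M z hzO).continuousAt (hO.mem_nhds hzO)
  exact ge_of_tendsto (hcont.tendsto.comp hlim) (Filter.Eventually.of_forall fun n => (hu n).2)

/-- Relative closedness of a sublevel set of the size in the exterior. [folklore] -/
theorem closure_setOf_M_le_inter {c : ℝ} : closure {z | z ∈ V.O ∧ V.M z ≤ c} ∩ V.O ⊆ {z | z ∈ V.O ∧ V.M z ≤ c} := by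
  rintro z ⟨hz, hzO⟩
  refine ⟨hzO, ?_⟩
  obtain ⟨u, hu, hlim⟩ := mem_closure_iff_seq_limit.1 hz
  have hO : IsOpen V.O := by
    have : V.O = (modelHandlebody k ∪ V.disc)ᶜ := by ext x; simp [CollarDatum.O, CollarDatum.disc]
    rw [this]; exact ((isClosed_modelHandlebody k).union V.isClosed_disc).isOpen_compl
  have hcont : ContinuousAt V.M z := (V.continuousOn_M z hzO).continuousAt (hO.mem_nhds hzO)
  exact le_of_tendsto (hcont.tendsto.comp hlim) (Filter.Eventually.of_forall fun n => (hu n).2)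

end CollarDatum

end FriendsVk

/-- **Helper `helper_friendsCarrier_Vk_partC_size`** (registered piece 7 of `helper_friendsCarrier_Vk_partC`,
line `mk_friends`, crux `DcrGap`): under the hypotheses of part C, the collar `c : Y × ℝ → ℝ⁴` of the
uninverted model disc exterior has NEAR-END PARTS `c(Y × (-∞, a])` that are relatively closed in the exterior
`E = ℝ⁴ ∖ (D_k ∪ Δ)`: each is `E ∩ C` for a closed `C ⊆ ℝ⁴` (they accumulate only at `D_k ∪ Δ`; size-function
argument of the tree's `SliceDiscEndCollar.lean`, Manolescu–Piccirillo 2023, §3.2). [cite: ManolescuPiccirillo2023, §3.2] -/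
theorem helper_friendsCarrier_Vk_partC_size : ∀ (k : ℕ) (K₁ : (sphere (0 : EuclideanSpace ℝ (Fin 2)) 1) → EuclideanSpace ℝ (Fin 4)) (Φ : ℝ × EuclideanSpace ℝ (Fin 4) → EuclideanSpace ℝ (Fin 4)) (ε s₁ s₀ : ℝ) (g : EuclideanSpace ℝ (Fin 2) → EuclideanSpace ℝ (Fin 4)) (G : EuclideanSpace ℝ (Fin 2) × EuclideanSpace ℝ (Fin 2) → EuclideanSpace ℝ (Fin 4)) (ν : (sphere (0 : EuclideanSpace ℝ (Fin 2)) 1) × EuclideanSpace ℝ (Fin 2) → EuclideanSpace ℝ (Fin 4)), IsModelKnot k K₁ → ContDiff ℝ ∞ Φ → (∀ x, Φ (0, x) = x) → (∀ s t x, Φ (s, Φ (t, x)) = Φ (s + t, x)) → 0 < ε → ε ≤ 1 / 4 → (∀ x ∈ modelBoundary k, ∀ s : ℝ, |s| ≤ 2 * ε → (∀ j, (1 : ℝ) / 2 < holeTerm k j (Φ (s, x))) ∧ levelFun k (Φ (s, x)) = 1 + s) → (∀ y, (∀ j, 0 < holeTerm k j y) → |levelFun k y - 1| < 2 * ε → Φ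 (1 - levelFun k y, y) ∈ modelBoundary k) → 0 < s₀ → s₀ < s₁ → s₁ < 2 * ε → IsModelSliceDisc k K₁ g → (∀ (u : (sphere (0 : EuclideanSpace ℝ (Fin 2)) 1)) (t : ℝ), 1 - s₁ ≤ t → t ≤ 1 → g (t • (u : EuclideanSpace ℝ (Fin 2))) = Φ (1 - t, K₁ u)) → (ContDiffOn ℝ ∞ G (ball 0 1 ×ˢ ball 0 2) ∧ InjOn G (ball 0 1 ×ˢ ball 0 2) ∧ (∀ q ∈ ball 0 1 ×ˢ ball 0 2, Injective (fderiv ℝ G q)) ∧ (∀ q ∈ ball 0 1 ×ˢ ball 0 2, G q ∉ modelHandlebody k) ∧ (∀ x ∈ ball 0 1, G (x, 0) = g x)) → (∀ (u : (sphere (0 : EuclideanSpace ℝ (Fin 2)) 1)) (t : ℝ) (w : EuclideanSpace ℝ (Fin 2)), 1 - s₁ < t → t < 1 → ‖w‖ < 2 → G (t • (u : EuclideanSpace ℝ (Fin 2)), w) = Φ (1 - t, ν (u, w))) → (∀ (x w : EuclideanSpace ℝ (Fin 2)), ‖x‖ ≤ 1 - s₀ → ‖w‖ < 2 → ∀ a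 ∈ modelBoundary k, ∀ s : ℝ, 0 < s → s < s₀ → G (x, w) ≠ Φ (s, a)) → ∀ (Y : Type) [TopologicalSpace Y] [T2Space Y] [SecondCountableTopology Y] [ChartedSpace (EuclideanSpace ℝ (Fin 3)) Y] [IsManifold (𝓡 3) ∞ Y] (jB : solidTorus → Y) (jM : EuclideanSpace ℝ (Fin 4) → Y) (W : Set (EuclideanSpace ℝ (Fin 4))) (ψ : Y → EuclideanSpace ℝ (Fin 4)), (Manifold.IsSmoothEmbedding (𝓘(ℝ, EuclideanSpace ℝ (Fin 2)).prod (𝓡 1)) (𝓡 3) ∞ jB ∧ IsOpen (range jB) ∧ ContMDiff ((𝓡 1).prod 𝓘(ℝ, EuclideanSpace ℝ (Fin 2))) 𝓘(ℝ, EuclideanSpace ℝ (Fin 4)) ∞ ν ∧ Injective ν ∧ (∀ p, Injective (mfderiv ((𝓡 1).prod 𝓘(ℝ, EuclideanSpace ℝ (Fin 2))) 𝓘(ℝ, EuclideanSpace ℝ (Fin 4)) ν p)) ∧ (∀ p, ν p ∈ modelBoundary k) ∧ (∀ u : (sphere (0 : EuclideanSpace ℝ (Fin 2)) 1), ν (u,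 0) = K₁ u) ∧ IsOpen W ∧ (∀ x ∈ modelBoundary k, x ∉ range K₁ → x ∈ W) ∧ ContMDiffOn 𝓘(ℝ, EuclideanSpace ℝ (Fin 4)) (𝓡 3) ∞ jM W ∧ IsOpen (jM '' {x : EuclideanSpace ℝ (Fin 4) | x ∈ modelBoundary k ∧ x ∉ range K₁}) ∧ ContMDiffOn (𝓡 3) 𝓘(ℝ, EuclideanSpace ℝ (Fin 4)) ∞ ψ (jM '' {x : EuclideanSpace ℝ (Fin 4) | x ∈ modelBoundary k ∧ x ∉ range K₁}) ∧ (∀ x ∈ modelBoundary k, x ∉ range K₁ → ψ (jM x) = x) ∧ jM '' {x : EuclideanSpace ℝ (Fin 4) | x ∈ modelBoundary k ∧ x ∉ range K₁} ∪ range jB = univ ∧ (∀ x ∈ modelBoundary k, x ∉ range K₁ → ∀ b : solidTorus, jM x = jB b ↔ ∃ (u : (sphere (0 : EuclideanSpace ℝ (Fin 2)) 1)) (t : ℝ), t ∈ Ioo (0 : ℝ) 1 ∧ b.1.1 = t • (u : EuclideanSpace ℝ (Fin 2)) ∧ x = ν (u, t • (b.1.2 : EuclideanSpace ℝ (Fin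 2))))) → ∃ c : Y × ℝ → EuclideanSpace ℝ (Fin 4), Injective c ∧ ∀ a : ℝ, ∃ C : Set (EuclideanSpace ℝ (Fin 4)), IsClosed C ∧ c '' {p | p.2 ≤ a} = C ∩ {x | x ∉ modelHandlebody k ∧ x ∉ g '' closedBall 0 1} := by
  intro k K₁ Φ ε s₁ s₀ g G ν hK hΦ hΦ0 hΦadd hε hε4 hclock hband hs₀ hs₀₁ hs₁ε hg hgcone hG hGcone hdeep Y _ _ _ _ _ jB jM W ψ
    ⟨h1, h2, h3, h4, h5, h6, h7, h8, h9, h10, h11, h12, h13, h14, h15⟩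
  let V : FriendsVk.CollarDatum k :=
    FriendsVk.CollarDatum.datumOf hK hΦ hΦ0 hΦadd hε hε4 hclock hband hs₀ hs₀₁ hs₁ε hg hgcone hG hGcone hdeep h3 h4 h5 h6 h7
  obtain ⟨Q, hQM, hQB, hQψ⟩ := FriendsVk.CollarDatum.Pres.ofHyp_spec V h1 h2 h8 h9 h10 h11 h12 h13 h14 h15
  refine ⟨V.collar Q.jM Q.jB Q.ψ, Q.collar_injective, fun a => ⟨closure {z | z ∈ V.O ∧ Real.exp (-a) ≤ V.M z}, isClosed_closure, ?_⟩⟩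
  rw [Q.image_collar_le]
  refine Subset.antisymm (fun z hz => ⟨subset_closure hz, hz.1⟩) ?_
  exact V.closure_setOf_le_M_inter

end Summit.SmoothPoincare4.SmoothPoincare4.Theorems.DcrGap.MkFriends

end
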